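import Mathlib
import Summits.ValiantsHypothesis.ValiantsHypothesis.Theorems.KPlusLogSqLawWeakLiftingTowerGraftOperatorRouche

/-!
# Tower graft line — the ADJUGATE (Neumann) MARGIN: base-dominance for the matrix-level Rouché count measured AFTER
# dividing by the base `F₀` (inverse-free form of `‖F₀⁻¹·Q‖_∞ < 1`)

Instrument file for LINE (B) `Cruxes/WeakLifting/Lines/tower_graft.lean` (crux `WeakLifting` = stmt-ValiantsHypothesis-19561), memo
`tower_graft-S5.md` §3 T1 «log-slope localisation», continuing `…TowerGraftOperatorRouche` (#6: homotopy Rouché, `det (F₀ + Q)` vs `det F₀`)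
and `…TowerGraftOperatorRoucheDominance` (#9: Gershgorin row margin of `F₀` over `Q`).  #9's margin asks `F₀(τ)` ITSELF to be row-diagonally
dominant — a basis-dependent condition that a class pencil `G(τ)` rarely meets away from its own letter-dominant zones.  The natural hypothesis
of #6 is operator domination `‖F₀(τ)⁻¹ Q(τ)‖ < 1`; this file types its inverse-free, instance-free form:

§1 `det_add_smul_ne_zero_of_adjugateMargin` — if `Σ_j ‖(adj A · B)_{kj}‖ < ‖det A‖` for every row `k` (complex matrices), then
`det (A + l·B) ≠ 0` for every real `|l| ≤ 1`: `adj A · (A + l·B) = det A · 1 + l · adj A · B` is strictly row-diagonally dominant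
(Gershgorin), and `det (adj A) · det (A + l·B)` is its determinant.  (`adj A = det A · A⁻¹`, so the margin IS the max-row-sum bound
`‖A⁻¹B‖_∞ < 1` — Neumann: `1 + l·A⁻¹B` is a unit.)  `det A ≠ 0` is implied (`det_ne_zero_of_adjugateMargin`).
§2 `eval_det_homotopy_ne_zero_of_adjugateMargin` — the margin at a point `τ` for matrix POLYNOMIALS evaluated there gives #6's homotopy
hypothesis `det (F₀ + l·Q)(τ) ≠ 0`, `l ∈ [0,1]`.
§3 `card_roots_det_add_eq_of_adjugateMargin` / `card_posRoots_det_add_le_sum_discs_of_adjugateMargin` — the two Rouché counts of #6 under the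
adjugate margin on the circle(s): equal root counts in the disc / positive roots of a real graft charged to roots of `det F₀` in a disc system.
READING FOR THE LINE: for a graft `G + X^D·S` of ANY rank the base-dominant zone is now «`Σ_j |(adj G(τ)·τ^D S)_{kj}| < |det G(τ)|` on the
circle», i.e. `|τ|^D · ‖adj G(τ)·S‖_∞ < |det G(τ)|` — the far letter measured against the SMALLEST singular direction of the base, which is the
honest T1 condition; what lies between this zone and the letter zones (#10, `…SteepZone`) is S4's research content and is NOT addressed.
HONEST FRAMING: classical linear algebra (Gershgorin after an adjugate multiplication); nothing on S4/S4b/S5, TowerB, `WeakLifting`, Conjecture B,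
18050 or VP ≠ VNP.  Def-free; Mathlib + #6.  Seat: prover val-sym-lift-p2 g23, `--supports stmt-ValiantsHypothesis-19561 --as helper`.
[folklore: Gershgorin / Neumann series; the packaging for the line is this work]
-/

-- `Summit.ValiantsHypothesis.ValiantsHypothesis.…` repeats a component by the D-0017 layout
-- (single-conjunct summit), which the `dupNamespace` linter flags; the name is mandated.
set_option linter.dupNamespace false

namespace Summit.ValiantsHypothesis.ValiantsHypothesis.Theorems.KPlusLogSqLaw.TowerGraft

open Polynomial Complex
open scoped BigOperators Polynomial

/-! ## §1 The adjugate margin ⇒ the whole homotopy is non-singular -/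

section Margin

variable {n : Type*} [Fintype n] [DecidableEq n]

/-- the adjugate margin forces `det A ≠ 0` (for a nonempty index type the row sum is `≥ 0`; for an empty one `det A = 1`). [folklore] -/
theorem det_ne_zero_of_adjugateMargin (A B : Matrix n n ℂ)
    (h : ∀ k, (∑ j, ‖(A.adjugate * B) k j‖) < ‖A.det‖) : A.det ≠ 0 := by
  intro h0
  cases isEmpty_or_nonempty n with
  | inl _ => exact one_ne_zero (by rwa [Matrix.det_isEmpty] at h0)
  | inr hn =>
    obtain ⟨k⟩ := hn
    have hk := h k
    rw [h0, norm_zero] at hk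
    exact absurd hk (not_lt.mpr (Finset.sum_nonneg fun j _ => norm_nonneg _))

/-- `adj A · (A + l·B) = det A · 1 + l · (adj A · B)`. [folklore] -/
theorem adjugate_mul_add_smul (A B : Matrix n n ℂ) (l : ℂ) :
    A.adjugate * (A + l • B) = A.det • (1 : Matrix n n ℂ) + l • (A.adjugate * B) := by
  rw [Matrix.mul_add, Matrix.adjugate_mul, Matrix.mul_smul]

/-- **ADJUGATE (NEUMANN) MARGIN.**  If `Σ_j ‖(adj A · B) k j‖ < ‖det A‖` for every row `k` (complex matrices), then `det (A + l·B) ≠ 0`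
for every real `l` with `|l| ≤ 1`: `det A · 1 + l · adj A · B` is strictly row-diagonally dominant (Gershgorin) and equals `adj A · (A + l·B)`.
Inverse-free form of `‖A⁻¹ B‖_∞ < 1`. [folklore; packaging this work] -/
theorem det_add_smul_ne_zero_of_adjugateMargin (A B : Matrix n n ℂ)
    (h : ∀ k, (∑ j, ‖(A.adjugate * B) k j‖) < ‖A.det‖) {l : ℝ} (hl : |l| ≤ 1) :
    (A + (l : ℂ) • B).det ≠ 0 := by
  intro hdet
  set P : Matrix n n ℂ := A.adjugate * B with hP
  -- the dominant matrix `M = det A • 1 + l • P` has determinant `det (adj A) · det (A + lB) = 0`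
  have hM0 : (A.det • (1 : Matrix n n ℂ) + (l : ℂ) • P).det = 0 := by
    rw [hP, ← adjugate_mul_add_smul, Matrix.det_mul, hdet, mul_zero]
  refine absurd hM0 (det_ne_zero_of_sum_row_lt_diag fun k => ?_)
  have hlP : ∀ i j, ‖(l : ℂ) * P i j‖ ≤ ‖P i j‖ := by
    intro i j
    rw [norm_mul, Complex.norm_real, Real.norm_eq_abs]
    calc |l| * ‖P i j‖ ≤ 1 * ‖P i j‖ := mul_le_mul_of_nonneg_right hl (norm_nonneg _)
      _ = ‖P i j‖ := one_mul _
  -- off-diagonal entries of `M` in row `k` are `l · P k j`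
  have hoff : (∑ j ∈ Finset.univ.erase k, ‖(A.det • (1 : Matrix n n ℂ) + (l : ℂ) • P) k j‖) ≤
      ∑ j ∈ Finset.univ.erase k, ‖P k j‖ := by
    refine Finset.sum_le_sum fun j hj => ?_
    have hjk : j ≠ k := Finset.ne_of_mem_erase hj
    rw [Matrix.add_apply, Matrix.smul_apply, Matrix.smul_apply, Matrix.one_apply_ne' hjk, smul_zero, zero_add,
      smul_eq_mul]
    exact hlP k j
  -- the diagonal entry of `M` in row `k` is `det A + l · P k k`
  have hdiag : ‖A.det‖ - ‖P k k‖ ≤ ‖(A.det • (1 : Matrix n n ℂ) + (l : ℂ) • P) k k‖ := by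
    rw [Matrix.add_apply, Matrix.smul_apply, Matrix.smul_apply, Matrix.one_apply_eq, smul_eq_mul, mul_one, smul_eq_mul]
    have h1 : ‖A.det‖ ≤ ‖A.det + (l : ℂ) * P k k‖ + ‖(l : ℂ) * P k k‖ := by
      have := norm_add_le (A.det + (l : ℂ) * P k k) (-((l : ℂ) * P k k))
      rwa [add_neg_cancel_right, norm_neg] at this
    linarith [hlP k k]
  -- the full row sum of `P` splits as the diagonal term plus the off-diagonal ones
  have hsplit : ‖P k k‖ + ∑ j ∈ Finset.univ.erase k, ‖P k j‖ = ∑ j, ‖P k j‖ :=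
    Finset.add_sum_erase _ (fun j => ‖P k j‖) (Finset.mem_univ k)
  have hk := h k
  linarith

/-- column form: if `Σ_i ‖(B · adj A) i k‖ < ‖det A‖` for every column `k`, then `det (A + l·B) ≠ 0` for `|l| ≤ 1` (transpose). [folklore] -/
theorem det_add_smul_ne_zero_of_adjugateMargin_col (A B : Matrix n n ℂ)
    (h : ∀ k, (∑ i, ‖(B * A.adjugate) i k‖) < ‖A.det‖) {l : ℝ} (hl : |l| ≤ 1) :
    (A + (l : ℂ) • B).det ≠ 0 := by
  have ht : (A.transpose + (l : ℂ) • B.transpose).det ≠ 0 := by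
    refine det_add_smul_ne_zero_of_adjugateMargin _ _ (fun k => ?_) hl
    rw [Matrix.det_transpose, ← Matrix.adjugate_transpose, ← Matrix.transpose_mul]
    simpa only [Matrix.transpose_apply] using h k
  rwa [← Matrix.transpose_smul, ← Matrix.transpose_add, Matrix.det_transpose] at ht

end Margin

/-! ## §2 The margin at a point of the circle for matrix polynomials -/

section Eval

variable {n : Type*} [Fintype n] [DecidableEq n]

/-- evaluation at `τ` of the homotopy determinant is the determinant of the evaluated matrices. [folklore] -/
theorem eval_det_add_C_smul (F₀ Q : Matrix n n ℂ[X]) (τ : ℂ) (l : ℂ) :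
    ((F₀ + C l • Q).det).eval τ = (F₀.map (Polynomial.eval τ) + l • Q.map (Polynomial.eval τ)).det := by
  rw [← Polynomial.coe_evalRingHom, RingHom.map_det, RingHom.mapMatrix_apply]
  congr 1
  ext i j
  simp [Matrix.map_apply, Matrix.add_apply, Matrix.smul_apply]

/-- **the adjugate margin at a point gives the homotopy hypothesis of the matrix-level Rouché count** (#6): with `A = F₀(τ)`, `B = Q(τ)`,
`Σ_j ‖(adj A · B) k j‖ < ‖det A‖` for every row `k` ⇒ `det (F₀ + l·Q)(τ) ≠ 0` for `l ∈ [0,1]`. [this work] -/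
theorem eval_det_homotopy_ne_zero_of_adjugateMargin (F₀ Q : Matrix n n ℂ[X]) (τ : ℂ)
    (h : ∀ k, (∑ j, ‖((F₀.map (Polynomial.eval τ)).adjugate * Q.map (Polynomial.eval τ)) k j‖) <
      ‖(F₀.map (Polynomial.eval τ)).det‖)
    {l : ℝ} (hl0 : 0 ≤ l) (hl1 : l ≤ 1) :
    ((F₀ + C (l : ℂ) • Q).det).eval τ ≠ 0 := by
  rw [eval_det_add_C_smul]
  exact det_add_smul_ne_zero_of_adjugateMargin _ _ h (abs_le.mpr ⟨by linarith, hl1⟩)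

/-- the base determinant evaluated at `τ` is the determinant of the evaluated base (to read the margin's right-hand side as `|det F₀ (τ)|`).
[folklore] -/
theorem eval_det_eq_det_map_eval (F₀ : Matrix n n ℂ[X]) (τ : ℂ) :
    (F₀.det).eval τ = (F₀.map (Polynomial.eval τ)).det := by
  rw [← Polynomial.coe_evalRingHom, RingHom.map_det, RingHom.mapMatrix_apply]

end Eval

/-! ## §3 The Rouché counts under the adjugate margin -/

section Counts

variable {n : Type*} [Fintype n] [DecidableEq n]

/-- **MATRIX-LEVEL ROUCHÉ UNDER THE ADJUGATE MARGIN.**  If at every point `τ` of the circle `|τ − c| = R` (`R > 0`) the adjugate margin of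
`F₀(τ)` over `Q(τ)` holds, then `det (F₀ + Q)` and `det F₀` have the same number of roots (with multiplicity) in the open disc. [this work] -/
theorem card_roots_det_add_eq_of_adjugateMargin (F₀ Q : Matrix n n ℂ[X]) (c : ℂ) {R : ℝ} (hR : 0 < R)
    (h : ∀ τ ∈ Metric.sphere c R, ∀ k,
      (∑ j, ‖((F₀.map (Polynomial.eval τ)).adjugate * Q.map (Polynomial.eval τ)) k j‖) < ‖(F₀.map (Polynomial.eval τ)).det‖) :
    Multiset.card ((F₀ + Q).det.roots.filter fun z => dist z c < R) =
      Multiset.card (F₀.det.roots.filter fun z => dist z c < R) :=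
  card_roots_det_add_eq_of_homotopy F₀ Q c hR fun _ hl0 hl1 τ hτ =>
    eval_det_homotopy_ne_zero_of_adjugateMargin F₀ Q τ (h τ hτ) hl0 hl1

/-- **REAL-GRAFT FORM UNDER THE ADJUGATE MARGIN.**  Real matrix polynomials `F₀`, `Q` (for the line: `F₀ = G` a class pencil, `Q = X^D·S` a
far letter of ANY rank); discs `B(ctr i, rad i)` on whose circles the complexified adjugate margin holds and which cover every positive root of
`det (F₀ + Q)`: then `Z₊(det (F₀ + Q)) ≤ Σᵢ #{roots of det F₀ in disc i, with multiplicity}`. [this work] -/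
theorem card_posRoots_det_add_le_sum_discs_of_adjugateMargin (F₀ Q : Matrix n n ℝ[X]) {ι : Type*} (I : Finset ι) (ctr : ι → ℂ)
    (rad : ι → ℝ) (hrad : ∀ i ∈ I, 0 < rad i)
    (h : ∀ i ∈ I, ∀ τ ∈ Metric.sphere (ctr i) (rad i), ∀ k,
      (∑ j, ‖(((F₀.map (Polynomial.map Complex.ofRealHom)).map (Polynomial.eval τ)).adjugate *
          (Q.map (Polynomial.map Complex.ofRealHom)).map (Polynomial.eval τ)) k j‖) <
        ‖((F₀.map (Polynomial.map Complex.ofRealHom)).map (Polynomial.eval τ)).det‖)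
    (hcov : ∀ t : ℝ, 0 < t → ((F₀ + Q).det).eval t = 0 → ∃ i ∈ I, dist (t : ℂ) (ctr i) < rad i) :
    (((F₀ + Q).det).roots.toFinset.filter (fun t => 0 < t)).card ≤
      ∑ i ∈ I, Multiset.card (((F₀.det).map Complex.ofRealHom).roots.filter fun z => dist z (ctr i) < rad i) :=
  card_posRoots_det_add_le_sum_discs F₀ Q I ctr rad hrad
    (fun i hi _ hl0 hl1 τ hτ => eval_det_homotopy_ne_zero_of_adjugateMargin _ _ τ (h i hi τ hτ) hl0 hl1) hcov

end Counts

end Summit.ValiantsHypothesis.ValiantsHypothesis.Theorems.KPlusLogSqLaw.TowerGraft
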